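import Summits.BirchSwinnertonDyer.BirchSwinnertonDyer.Theorems.EdixhovenFibreFiveSevenStarredOptimalManinUnitFiveSevenCdtThm1
import Summits.BirchSwinnertonDyer.BirchSwinnertonDyer.Theorems.EdixhovenFibreFiveSevenKPTransportInputsOfModularity
import Summits.BirchSwinnertonDyer.BirchSwinnertonDyer.Theorems.EdixhovenFibreFiveSevenKPResidueOfCornerLow
import Summits.BirchSwinnertonDyer.BirchSwinnertonDyer.Theorems.EdixhovenFibreFiveSevenKummerCornerTorsionOptimalManinUnitCdtThm1
import Summits.BirchSwinnertonDyer.BirchSwinnertonDyer.Theorems.EdixhovenFibreFiveSevenSupersingularTorsionOptimalManinUnitFiveCdtThm1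
import HarnessLib

set_option autoImplicit false
-- the sub-problem namespace `Summit.BirchSwinnertonDyer.BirchSwinnertonDyer` duplicates a component by design (D-0017)
set_option linter.dupNamespace false

/-!
# Crux KP57 `KPResidueManinUnitFiveSeven` (stmt-BirchSwinnertonDyer-23810) MODULO MODULARITY ONLY — `--supports`, a record

After K★ (22226), CORNER (23883) and LOW (23884) were closed by name from the Calegari–Dimitrov–Tang theorem (now the tree theorem
`calegariDimitrovTang2025_unboundedDenominators_holds`), the ONLY input of KP57 that is not a theorem of the tree is modularity of
elliptic curves over `ℚ` in the tree's newform form, `exists_isNewformOf` ([BCDTJAMS2001, Thm. A]; cite-only).  Unlike TDS57 /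
TDS11, the decl `KPResidueManinUnitFiveSeven` does NOT carry modularity as a binder: its conclusion produces a conductor-level
parametrisation datum of `V`, which cannot exist without a newform of `V`.  Two independent one-hypothesis closers are recorded:

* `kpResidueManinUnitFiveSeven_of_modularity`  — `EdixhovenFibreFiveSevenOfCDTInt.kpResidueManinUnitFiveSeven_of_CDTInt_of_modularity`
  (p811415) with its CDT key discharged;
* `kpResidueManinUnitFiveSeven_of_modularity'` — through the route's own split: the proved glue `KPResidueOfCornerLow` (24320) over
  the now-closed children CORNER / LOW and `kpTransportInputs_of_modularity` (24319 ⟸ modularity, Dokchitser–Dokchitser being a theorem).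

HONEST STATUS: CONDITIONAL on the cite-only printed fact `exists_isNewformOf`; the item stays OPEN by name (planner: re-filing KP57
with `exists_isNewformOf →` as first binder, as TDS57/TDS11 have it, would make it closable at once).  BSD is not proved by this.
[cite: BreuilConradDiamondTaylor2001, Thm. A] [cite: CalegariDimitrovTang2025, Thm. 1.0.1] [cite: KostersPannekoek2017, Thm. 1 and Cor. 2]
-/

namespace Summit.BirchSwinnertonDyer.BirchSwinnertonDyer.Theorems

open Summit.BirchSwinnertonDyer.BirchSwinnertonDyer.Theses.EdixhovenFibreFiveSeven

/-- **KP57 `KPResidueManinUnitFiveSeven` (stmt-BirchSwinnertonDyer-23810) ⟸ modularity alone**: the Kosters–Pannekoek residue of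
Manin's `p`-part at `p ∈ {5, 7}` — `kpResidueManinUnitFiveSeven_of_CDTInt_of_modularity` with the CDT key discharged by
`calegariDimitrovTang2025_unboundedDenominators_holds`.  CONDITIONAL on `hnf`; the item is not closed by this; BSD is not proved by
this. [cite: BreuilConradDiamondTaylor2001, Thm. A] [cite: CalegariDimitrovTang2025, Thm. 1.0.1] -/
theorem kpResidueManinUnitFiveSeven_of_modularity
    (hnf : Literature.NumberTheory.EllipticCurves.ModularForms.exists_isNewformOf) : KPResidueManinUnitFiveSeven :=
  EdixhovenFibreFiveSevenOfCDTInt.kpResidueManinUnitFiveSeven_of_CDTInt_of_modularity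
    calegariDimitrovTang2025_unboundedDenominators_holds hnf

/-- **KP57 ⟸ modularity, through the route's own split** `CORNER → LOW → KPTransportInputs → KP57` (proved glue
`KPResidueOfCornerLow.kpResidueOfCornerLow_proof`, 24320) over the closed children `KummerCornerTorsionOptimalManinUnit_proof`
(23883), `SupersingularTorsionOptimalManinUnitFive_proof` (23884) and `kpTransportInputs_of_modularity` (24319 ⟸ modularity).
CONDITIONAL on `hnf`; the item is not closed by this; BSD is not proved by this. [cite: BreuilConradDiamondTaylor2001, Thm. A]
[cite: KostersPannekoek2017, Thm. 1 and Cor. 2] -/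
theorem kpResidueManinUnitFiveSeven_of_modularity'
    (hnf : Literature.NumberTheory.EllipticCurves.ModularForms.exists_isNewformOf) : KPResidueManinUnitFiveSeven :=
  KPResidueOfCornerLow.kpResidueOfCornerLow_proof KummerCornerTorsionOptimalManinUnit_proof
    SupersingularTorsionOptimalManinUnitFive_proof (kpTransportInputs_of_modularity hnf)

end Summit.BirchSwinnertonDyer.BirchSwinnertonDyer.Theorems
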